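import Mathlib.LinearAlgebra.Quotient.Basic
import Mathlib.LinearAlgebra.Isomorphisms
import Mathlib.GroupTheory.Index
import Mathlib.Data.Set.Finite.Lattice
import Mathlib.SetTheory.Cardinal.Finite
import Mathlib.Data.Nat.Find
import Mathlib.Tactic.Group
import Mathlib.Tactic.Abel
import Mathlib.Tactic.Push
import HarnessLib

/-!
# Finitely many classes of the fixed part `A^P` modulo `(ρ(σ₁) − 1)A^P` from FINITELY MANY `⟨P, σ₁⟩`-FIXED VECTORS in a
# `p`-primary module with finite `p^k`-torsion ((FIX) ⟹ (FIN-N); helper, `--supports stmt-BirchSwinnertonDyer-25505`)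

Cell `bsd-stepL`, seat `bsd-stepL-imc-p1` (prover g23, 2026-08-28). Theorems only (no definition, no named fact, no `sorry`, no
instance, no notation). Pure algebra for the one remaining Galois input (FIN-N) of line `erratum_chain` of crux 25505 (memo
`LOCALDEFECT-25505-imc-p1-g23.md` §1): it REDUCES (FIN-N) — "the classes of `N = A^P` modulo `(ρ(σ₁) − 1)N` are finitely many" —
to (FIX) — "only finitely many `a ∈ A` are fixed by `P` and by `σ₁`" (`= "V^{⟨P, σ₁⟩} = 0"` of memo g22 §2.2) — for any group `G`
acting `𝒪`-linearly on a `p`-primary `A` whose `p^k`-torsion is finite for every `k` (e.g. `A_g = K²/𝒪²`) and any predicate `P`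
normalised by `σ₁`. Proof: `N = ⋃_j N[p^j]` with `N[p^j]` FINITE and stable under `u = ρ(σ₁) − 1`; on a finite module
`#(M/uM) = #ker(u|M) ≤ #Fix`; a family of pairwise incongruent elements of `N` lies in one `N[p^j]` and stays incongruent there, so
has at most `#Fix` members; a maximal such family represents every class.

* `card_quotient_range_eq_card_ker` — `#(M ⧸ range f) = #(ker f)` for an endomorphism of a finite module.
* `exists_finset_repr_of_finite_fixed` — (FIX) ⟹ (FIN-N) in the finset form consumed by
  `LocalDefect.finite_quotSMulTop_X_invariants` ∕ `LocalDefectAtData.*`.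

HONEST FRAMING: algebra; nothing about any newform or curve; conditional on nothing; BSD proved for no pair; closes: none (T7).

## References
* [JetchevSkinnerWan2017] §3.3 Case 3(b), §3.4 Lemma 3.4.1 (arXiv:1512.06894 pp. 13–14: finiteness of `𝓜^{G_{K_v}}/(γ₊−1)` via
  fixed vectors).
* [SerreLocalFields1979] XIII §1 (Herbrand quotient bookkeeping `#coker = #ker` on finite modules).
-/

-- D-0017: single-problem summit, the namespace repeats the problem name by design.
set_option linter.dupNamespace false
set_option autoImplicit false

namespace Summit.BirchSwinnertonDyer.BirchSwinnertonDyer.Theorems.ErratumThm23TwoVariable.FinN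

/-! ## §1 `#(M/uM) = #ker u` on a finite module -/

/-- **On a FINITE module an endomorphism has `#(M ⧸ range f) = #(ker f)`** (`M/ker f ≅ range f` and the two index formulas).
[cite: SerreLocalFields1979, Ch. XIII §1 (Herbrand quotient of a finite module)] -/
theorem card_quotient_range_eq_card_ker {R : Type*} [Ring R] {M : Type*} [AddCommGroup M] [Module R M] [Finite M]
    (f : M →ₗ[R] M) : Nat.card (M ⧸ LinearMap.range f) = Nat.card (LinearMap.ker f) := by
  have h₁ : Nat.card M = Nat.card (M ⧸ LinearMap.ker f) * Nat.card (LinearMap.ker f) :=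
    (LinearMap.ker f).toAddSubgroup.card_eq_card_quotient_mul_card_addSubgroup
  have h₂ : Nat.card M = Nat.card (M ⧸ LinearMap.range f) * Nat.card (LinearMap.range f) :=
    (LinearMap.range f).toAddSubgroup.card_eq_card_quotient_mul_card_addSubgroup
  have h₃ : Nat.card (M ⧸ LinearMap.ker f) = Nat.card (LinearMap.range f) := Nat.card_congr f.quotKerEquivRange.toEquiv
  rw [h₃, mul_comm] at h₁
  have hpos : 0 < Nat.card (LinearMap.range f) := Nat.card_pos
  exact Nat.eq_of_mul_eq_mul_right hpos (h₂.symm.trans h₁)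

/-! ## §2 (FIX) ⟹ (FIN-N) -/

/-- **Finitely many `⟨P, σ₁⟩`-fixed vectors ⟹ finitely many classes of `A^P` modulo `(ρ(σ₁) − 1)A^P`** for a `p`-primary `A`
with finite `p^k`-torsion (all `k`), `G` acting `𝒪`-linearly through `ρ`, `P = P₁ ∧ P₂` a predicate on `G` (curried, as in the line's binders) stable under
conjugation by `σ₁` (so that `u = ρ(σ₁) − 1` preserves `N = A^P`). The finset form: there is a finite `S ⊆ A` with every `a ∈ N` of the form
`s + (ρ(σ₁) b − b)`, `s ∈ S`, `b ∈ N`. [cite: JetchevSkinnerWan2017, §3.4, Lemma 3.4.1, proof (arXiv:1512.06894 p. 14)] -/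
theorem exists_finset_repr_of_finite_fixed {𝒪 : Type*} [CommRing 𝒪] {A : Type*} [AddCommGroup A] [Module 𝒪 A]
    {G : Type*} [Group G] {F : Type*} [FunLike F G (A →ₗ[𝒪] A)] [MonoidHomClass F G (A →ₗ[𝒪] A)] (ρ : F)
    (P₁ P₂ : G → Prop) (σ₁ : G) (hconj₁ : ∀ σ, P₁ σ → P₁ (σ₁⁻¹ * σ * σ₁))
    (hconj₂ : ∀ σ, P₂ σ → P₂ (σ₁⁻¹ * σ * σ₁)) {p : ℕ}
    (hA : ∀ a : A, ∃ k : ℕ, p ^ k • a = 0) (htors : ∀ k : ℕ, {a : A | p ^ k • a = 0}.Finite)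
    (hfix : {a : A | (∀ σ, P₁ σ → P₂ σ → ρ σ a = a) ∧ ρ σ₁ a = a}.Finite) :
    ∃ S : Finset A, ∀ a : A, (∀ σ, P₁ σ → P₂ σ → ρ σ a = a) →
      ∃ s ∈ S, ∃ b : A, (∀ σ, P₁ σ → P₂ σ → ρ σ b = b) ∧ a = s + (ρ σ₁ b - b) := by
  classical
  -- one predicate `P = P₁ ∧ P₂`
  let P : G → Prop := fun σ ↦ P₁ σ ∧ P₂ σ
  have hconj : ∀ σ, P σ → P (σ₁⁻¹ * σ * σ₁) := fun σ h ↦ ⟨hconj₁ σ h.1, hconj₂ σ h.2⟩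
  have hcur : ∀ a : A, (∀ σ, P₁ σ → P₂ σ → ρ σ a = a) ↔ (∀ σ, P σ → ρ σ a = a) :=
    fun a ↦ ⟨fun h σ hσ ↦ h σ hσ.1 hσ.2, fun h σ h₁ h₂ ↦ h σ ⟨h₁, h₂⟩⟩
  simp only [hcur] at hfix ⊢
  -- the fixed part `N` and its `p^j`-torsion levels, all stable under `u = ρ σ₁ − 1`
  have hu : ∀ a : A, (∀ σ, P σ → ρ σ a = a) → ∀ σ, P σ → ρ σ (ρ σ₁ a - a) = ρ σ₁ a - a := by
    intro a ha σ hσ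
    have e : σ * σ₁ = σ₁ * (σ₁⁻¹ * σ * σ₁) := by group
    rw [map_sub, ha σ hσ, ← Module.End.mul_apply, ← map_mul, e, map_mul, Module.End.mul_apply, ha _ (hconj σ hσ)]
  let Nj : ℕ → Submodule 𝒪 A := fun j ↦
    { carrier := {a | (∀ σ, P σ → ρ σ a = a) ∧ p ^ j • a = 0}
      zero_mem' := ⟨fun σ _ ↦ map_zero _, smul_zero _⟩
      add_mem' := fun {a b} ha hb ↦ ⟨fun σ hσ ↦ by rw [map_add, ha.1 σ hσ, hb.1 σ hσ], by rw [smul_add, ha.2, hb.2, add_zero]⟩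
      smul_mem' := fun c a ha ↦ ⟨fun σ hσ ↦ by rw [map_smul, ha.1 σ hσ], by rw [smul_comm, ha.2, smul_zero]⟩ }
  have hNj : ∀ (j : ℕ) (a : A), a ∈ Nj j ↔ (∀ σ, P σ → ρ σ a = a) ∧ p ^ j • a = 0 := fun j a ↦ Iff.rfl
  haveI hNjfin : ∀ j : ℕ, Finite ↥(Nj j) := fun j ↦
    ((htors j).subset fun a (ha : a ∈ Nj j) ↦ ha.2).to_subtype
  have huj : ∀ (j : ℕ), ∀ a ∈ Nj j, ((ρ σ₁ : A →ₗ[𝒪] A) - 1) a ∈ Nj j := by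
    intro j a ha
    rw [hNj] at ha ⊢
    refine ⟨hu a ha.1, ?_⟩
    rw [LinearMap.sub_apply, Module.End.one_apply, smul_sub, ← map_nsmul, ha.2, map_zero, sub_zero]
  -- the bound `B = #Fix`
  haveI : Finite ↥{a : A | (∀ σ, P σ → ρ σ a = a) ∧ ρ σ₁ a = a} := hfix.to_subtype
  set B : ℕ := Nat.card ↥{a : A | (∀ σ, P σ → ρ σ a = a) ∧ ρ σ₁ a = a} with hB
  -- congruence modulo `u(N)`
  let Cong : A → A → Prop := fun a a' ↦ ∃ b : A, (∀ σ, P σ → ρ σ b = b) ∧ a - a' = ρ σ₁ b - b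
  have hCong_symm : ∀ a a', Cong a a' → Cong a' a := by
    rintro a a' ⟨b, hb, he⟩
    refine ⟨-b, fun σ hσ ↦ by rw [map_neg, hb σ hσ], ?_⟩
    rw [map_neg, ← neg_sub, he]; abel
  -- KEY BOUND: a finite family in `N`, pairwise incongruent, has at most `B` members
  have hbound : ∀ T : Finset A, (∀ t ∈ T, ∀ σ, P σ → ρ σ t = t) →
      (∀ t ∈ T, ∀ t' ∈ T, t ≠ t' → ¬ Cong t t') → T.card ≤ B := by
    intro T hTN hTinc
    -- a common torsion level `j`
    choose k hk using hA
    let j : ℕ := T.sup k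
    have hTj : ∀ t ∈ T, t ∈ Nj j := by
      intro t ht
      refine ⟨hTN t ht, ?_⟩
      obtain ⟨d, hd⟩ := Nat.exists_eq_add_of_le (Finset.le_sup (f := k) ht)
      change p ^ (T.sup k) • t = 0
      rw [hd, pow_add, mul_comm, mul_smul, hk, smul_zero]
    -- `u_j = u|N_j`, an endomorphism of the finite module `N_j`
    let uj : ↥(Nj j) →ₗ[𝒪] ↥(Nj j) := ((ρ σ₁ : A →ₗ[𝒪] A) - 1).restrict (huj j)
    -- `T ↪ N_j ⧸ range u_j`
    have hinj : Function.Injective (fun t : ↥T ↦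
        (Submodule.Quotient.mk (⟨(t : A), hTj t t.2⟩ : ↥(Nj j)) : ↥(Nj j) ⧸ LinearMap.range uj)) := by
      rintro ⟨t, ht⟩ ⟨t', ht'⟩ h
      by_contra hne
      have hne' : t ≠ t' := fun e ↦ hne (Subtype.ext e)
      apply hTinc t ht t' ht' hne'
      dsimp only at h
      rw [Submodule.Quotient.eq, LinearMap.mem_range] at h
      obtain ⟨⟨b, hb⟩, hbe⟩ := h
      have hbe' := congrArg Subtype.val hbe
      change ρ σ₁ b - b = t - t' at hbe'
      exact ⟨b, hb.1, hbe'.symm⟩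
    haveI : Finite (↥(Nj j) ⧸ LinearMap.range uj) :=
      Finite.of_surjective _ (Submodule.mkQ_surjective (LinearMap.range uj))
    have h1 : T.card ≤ Nat.card (↥(Nj j) ⧸ LinearMap.range uj) := by
      rw [← Nat.card_eq_finsetCard]
      exact Nat.card_le_card_of_injective _ hinj
    -- `#(N_j ⧸ range u_j) = #ker u_j ≤ #Fix = B`
    have h2 : Nat.card (↥(Nj j) ⧸ LinearMap.range uj) = Nat.card (LinearMap.ker uj) := card_quotient_range_eq_card_ker uj
    have h3 : Nat.card (LinearMap.ker uj) ≤ B := by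
      refine Nat.card_le_card_of_injective
        (fun x : ↥(LinearMap.ker uj) ↦ (⟨((x : ↥(Nj j)) : A), ?_⟩ : ↥{a : A | (∀ σ, P σ → ρ σ a = a) ∧ ρ σ₁ a = a})) ?_
      · refine ⟨(x : ↥(Nj j)).2.1, ?_⟩
        have hx := x.2
        rw [LinearMap.mem_ker] at hx
        have hx' := congrArg Subtype.val hx
        change ρ σ₁ ((x : ↥(Nj j)) : A) - ((x : ↥(Nj j)) : A) = 0 at hx'
        exact sub_eq_zero.mp hx'
      · rintro ⟨⟨x, hx⟩, hxk⟩ ⟨⟨y, hy⟩, hyk⟩ h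
        have h' : x = y := congrArg Subtype.val h
        subst h'
        rfl
    omega
  -- a MAXIMAL pairwise incongruent family inside `N`
  let Good : ℕ → Prop := fun m ↦ ∃ T : Finset A, (∀ t ∈ T, ∀ σ, P σ → ρ σ t = t) ∧
    (∀ t ∈ T, ∀ t' ∈ T, t ≠ t' → ¬ Cong t t') ∧ T.card = m
  have hGood0 : Good 0 := ⟨∅, by simp, by simp, rfl⟩
  let m₀ := Nat.findGreatest Good B
  have hm₀ : Good m₀ := Nat.findGreatest_spec (P := Good) (Nat.zero_le B) hGood0
  obtain ⟨T, hTN, hTinc, hTcard⟩ := hm₀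
  refine ⟨T, fun a ha ↦ ?_⟩
  -- every `a ∈ N` is congruent to a member of `T` (else `insert a T` would be a larger good family)
  by_contra hnone
  push Not at hnone
  have haT : a ∉ T := by
    intro haT
    exact (hnone a haT 0 (fun σ _ ↦ map_zero _)) (by rw [map_zero, sub_zero, add_zero])
  have hnc : ∀ t ∈ T, ¬ Cong a t := by
    rintro t ht ⟨b, hb, he⟩
    exact hnone t ht b hb (by rw [← he, add_sub_cancel])
  have hGood1 : Good (m₀ + 1) := by
    refine ⟨insert a T, ?_, ?_, by rw [Finset.card_insert_of_notMem haT, hTcard]⟩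
    · intro t ht
      rcases Finset.mem_insert.mp ht with hta | htT
      · rw [hta]; exact ha
      · exact hTN t htT
    · intro t ht t' ht' hne
      rcases Finset.mem_insert.mp ht with hta | htT <;> rcases Finset.mem_insert.mp ht' with hta' | htT'
      · exact absurd (hta.trans hta'.symm) hne
      · rw [hta]; exact hnc t' htT'
      · rw [hta']; exact fun h ↦ hnc t htT (hCong_symm _ _ h)
      · exact hTinc t htT t' htT' hne
  have hle : m₀ + 1 ≤ B := by
    obtain ⟨T₁, hT₁N, hT₁inc, hT₁card⟩ := hGood1
    rw [← hT₁card]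
    exact hbound T₁ hT₁N hT₁inc
  have := Nat.le_findGreatest hle hGood1
  omega

end Summit.BirchSwinnertonDyer.BirchSwinnertonDyer.Theorems.ErratumThm23TwoVariable.FinN
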